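import Summits.QuantumFields.YangMills.Theorems.BalabanUVNodesK0FlatWitnessB
import Summits.QuantumFields.YangMills.Theorems.BalabanUVNodesN07Thm1ScaledInterfaceInstance
import HarnessLib

/-!
# BalabanUVNodes ∕ K0⁷ — A6 FOR THE V23-SHAPED STUB-1 TEXT AT PRINT's DATUM: THE GRID GUARD IS MET FOR **EVERY** CHOICE OF ITS LETTERS `(c, c₀, c₁)`, AND THERE THE BINDER BLOCK OF
# `Prop8RegSepTopStepGB F N suppDom (grid guard c c₀ c₁) (lamDatum F) (dataSmall7LamTopOf F N) B₃ a₀ a₁` IS INHABITED — so an `∃ c c₀ c₁ B₃ a₀ a₁, … ∧ ∀-token` of this shape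
# (dag-n07-e's `exists_prop8RegSepTopStepGB_lam` ✓p767364; the plan's `K0V23Defs` candidate) is NOT «true by an unsatisfiable guard» ((E1)∕(iii-b), director-ym №338∕№343; FLAG №16)

Cell `pub-ymgap`, width seat `pub-ymgap-dag-n07-w3` g15 (CLAIM A6ᴮ-2, bus 2026-08-30 ≈09:15Z).  `--kind proof --supports stmt-QuantumFields-20541 --as helper` (K0⁷; count-neutral; def-free).
PURELY ADDITIVE; composes ✓p767123 `…K0FlatWitnessB` (flat-datum inhabitation under any guard met at the prefix letters) with an explicit set of prefix letters meeting the GRID GUARD of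
V22-Z's A‴ ∕ the V23 candidate (k0-s1-w3's `K0Stub1GridNumericsGuardWitness` §0 construction: `ν.r = 0`, so `R_j = 1` by dag-n07-e's `RkOfRecord_zero_r`).
[15] = [Balaban1985Variational]; [6] = [Balaban1985RegularSpaces]; [II] = [Balaban1984PropagatorsII]; [III] = [Balaban1988Convergent]; [I] = [Balaban1987RG1].

WHY.  The print-datum stub-1 text is `∃ (c c₀ c₁ : ℕ) (B₃ a₀ a₁ : ℝ), 2L² ≤ B₃ ∧ 0 < a₀ ∧ 0 < a₁ ∧ Prop8RegSepTopStepGB F 2 suppDom A‴ (lamDatum F) (dataSmall7LamTopOf F 2) B₃ a₀ a₁` with the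
GUARD `A‴ := fun ν M g K k _s => c ≤ ν.M₁ ∧ k + c₀ ≤ F.m + K ∧ F.L ^ c₁ ∣ M ∧ ∀ i, 1 ≤ i → i ≤ k → dCubeSide (F.P K).L M (RkOfRecord (F.P K).L ν.r (g i)) i ∣ (F.P K).sitesPerDir 0`
inside the ∀-token's prefix.  A refuter's first question about any `∃ letters, ∀-token(guard letters)` is whether the prover's letters make the guard UNSATISFIABLE (then the token holds
vacuously and certifies nothing — the HSEAM lesson one level up, `…N07SeamNotInhabited.not_hseam` ✓p765776).  §1 answers it uniformly: for EVERY `(c, c₀, c₁)` the guard is met at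
`ν := ⟨max c 1, 1, 0, 0, 0, 0, 0, 0⟩` (`0 < M₁`, `c ≤ M₁`, exponent `r = 0` so `R_j = 1`), `M := L^{c₁}`, `g ≡ 0`, `K := c₀ + c₁ + 1`, `k := 1` (`1 + c₀ ≤ m + K`; `L¹·L^{c₁}·1 ∣ 2·L^{m+K}`,
[III] (2.1) p. 254 with `T4Continuum.sitesPerDir_eq`); §2 feeds these letters to ✓p767123's flat witness: the whole binder block of the token at `(suppDom, A‴, lamDatum F, dataSmall7LamTopOf F N)`
— separated index, guard, thresholds, print's (7) data, the (6) class, print's (2.3) fibre, print-criticality — AND its conclusion (8) are jointly inhabited, for every `B₃, a₀, a₁ > 0`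
(in particular for the letters ✓p767364 chose, whatever they are).

WHAT IS PROVED (sorry-free; no definition; axioms standard).  §1 ★ `gridGuard_prefix_inhabited (F) (c c₀ c₁)`; §2 ★★★ `prop8RegSepTopStepGB_gridGuard_lam_binders_inhabited (F N) (c c₀ c₁)
(hB₃ : 0 < B₃) (ha₀ : 0 < a₀) (ha₁ : 0 < a₁)`, ★★ `halvingStepTopGB_gridGuard_lam_binders_inhabited` (Sect. F's one-step form at the same guard and datum).
HONEST FRAMING: A6 bookkeeping — the ∀-token is NOT asserted here (✓p767364 proves it; this file says its hypotheses are jointly satisfiable under every admissible guard choice, at the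
flat datum); nothing about Bałaban's analysis or non-flat data; V23 NOT registered; K0⁷ stub 1 NOT closed; N05 ∕ N07 NOT discharged; counts unmoved (typed 28∕28 · discharged 8∕28);
R4 = the conditional finite-𝕋⁴ rung `BalabanLadder.UV` ONLY; the YM mass gap (Clay) is NOT proved by any of this; nothing continuum ∕ ℝ⁴ ∕ OS.  No `sorry` ∕ `def` ∕ `instance` ∕ `notation`.

References: [15] Prop. 8 p. 304, (2)–(8) pp. 278–279; [6] (1.3)–(1.9) p. 77; [II] (2.1)–(2.3) p. 224; [III] (2.1) p. 254, (2.5) p. 255, (2.17)–(2.18) p. 257; [I] (0.1) p. 251.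
-/

set_option autoImplicit false

noncomputable section

open scoped Matrix.Norms.L2Operator

namespace Summit.QuantumFields.YangMills.BalabanUVNodes.K0GridGuardWitnessB

open Literature.MathematicalPhysics.QuantumFieldTheory.Balaban1983to89
open Literature.MathematicalPhysics.QuantumFieldTheory.Balaban1983to89.T4Continuum (T4Family)
open Literature.MathematicalPhysics.QuantumFieldTheory.Balaban1983to89.B15DeterminingSets
open Literature.MathematicalPhysics.QuantumFieldTheory.Balaban1983to89.B15DeterminingSetsB
open Literature.MathematicalPhysics.QuantumFieldTheory.Balaban1983to89.Node00
open Summit.QuantumFields.YangMills.BalabanUVNodes.N07Thm1ScaledInterfaceInstance (RkOfRecord_zero_r)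
open Summit.QuantumFields.YangMills.BalabanUVNodes.K0FlatWitnessB (prop8RegSepTopStepGB_binders_inhabited_flat_lam halvingStepTopGB_binders_inhabited_flat_lam)

/-! ## §1  The grid guard is met at explicit prefix letters, for every `(c, c₀, c₁)` -/

section Guard

/-- ★ **THE GRID GUARD OF THE V23-SHAPED TEXT IS SATISFIABLE FOR EVERY CHOICE OF ITS LETTERS**: for all `c c₀ c₁` there are prefix letters `ν` (`0 < M₁`), `M ≥ 1`, `g`, `K`, `k ≥ 1` with
`c ≤ ν.M₁ ∧ k + c₀ ≤ F.m + K ∧ F.L^{c₁} ∣ M ∧ ∀ i ∈ [1, k], dCubeSide L M R_i i ∣ sitesPerDir 0` — explicitly `ν := ⟨max c 1, 1, 0, …⟩` (`R_j = 1`), `M := L^{c₁}`, `g ≡ 0`, `K := c₀ + c₁ + 1`,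
`k := 1` (`L·L^{c₁} ∣ 2·L^{m+K}`).  [cite: Balaban1988Convergent, (2.1) p.254, (2.5) p.255, (2.17) p.257 (bookkeeping); Balaban1987RG1, (0.1) p.251] -/
theorem gridGuard_prefix_inhabited (F : T4Family) (c c₀ c₁ : ℕ) :
    ∃ (ν : Stage7Numerics) (M : ℕ) (g : ℕ → ℝ) (K k : ℕ), 0 < ν.M₁ ∧ 1 ≤ M ∧ 1 ≤ k ∧
      (c ≤ ν.M₁ ∧ k + c₀ ≤ F.m + K ∧ F.L ^ c₁ ∣ M ∧
        ∀ i, 1 ≤ i → i ≤ k → dCubeSide (F.P K).L M (RkOfRecord (F.P K).L ν.r (g i)) i ∣ (F.P K).sitesPerDir 0) := by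
  have hL : 0 < F.L := by have := F.hL11; omega
  refine ⟨⟨max c 1, 1, 0, 0, 0, 0, 0, 0⟩, F.L ^ c₁, fun _ => 0, c₀ + c₁ + 1, 1, lt_max_of_lt_right Nat.one_pos, Nat.one_le_pow _ _ hL, le_rfl,
    le_max_left _ _, by omega, dvd_rfl, fun i h1 hi => ?_⟩
  obtain rfl : i = 1 := le_antisymm hi h1
  rw [F.sitesPerDir_eq, T4Family.P_L]
  simp only [dCubeSide, RkOfRecord_zero_r, mul_one, pow_one]
  have e : F.L * F.L ^ c₁ = F.L ^ (c₁ + 1) := (pow_succ' F.L c₁).symm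
  rw [e]
  exact Dvd.dvd.mul_left (pow_dvd_pow F.L (by omega)) 2

end Guard

/-! ## §2  The binder block of the V23-shaped token is inhabited under EVERY grid guard, at print's datum -/

section Token

variable (F : T4Family) (N : ℕ) [NeZero N]

/-- ★★★ **A6 FOR THE V23-SHAPED STUB-1 TEXT, UNIFORM IN THE GUARD LETTERS**: for every `(c, c₀, c₁)` and every `B₃, a₀, a₁ > 0` there are prefix letters `(ν, M, g, K, k)`, an index `s`, a radius
`ε₀`, thresholds `δ`, a datum `W` and a configuration `U` meeting EVERY binder of
`Prop8RegSepTopStepGB F N (fun ν K Ω => suppDomOfRecord F ν K Ω) (grid guard c c₀ c₁) (lamDatum F) (dataSmall7LamTopOf F N) B₃ a₀ a₁` — the separated index, the GRID GUARD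
(`c ≤ ν.M₁ ∧ k + c₀ ≤ F.m + K ∧ F.L^{c₁} ∣ M ∧` torus-compatible `𝐃_i`-blocks), `1 ≤ k`, the threshold sandwich and comparability, `ε₀ ≤ a₀`, print's (7) data, the (6) class on the support,
print's (2.3) fibre, print-criticality — AND its conclusion (8), both halves (§1's letters fed to ✓p767123's flat witness).  Hence no choice of the ∃-letters of an
`∃ c c₀ c₁ B₃ a₀ a₁, 2L² ≤ B₃ ∧ 0 < a₀ ∧ 0 < a₁ ∧ Prop8RegSepTopStepGB …` statement makes its ∀-token vacuous.  The ∀-token is NOT asserted here.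
[cite: Balaban1985Variational, Prop. 8 p.304, (2)–(8) pp.278–279; Balaban1985RegularSpaces, (1.3)–(1.9) p.77; Balaban1984PropagatorsII, (2.3) p.224; Balaban1988Convergent, (2.1) p.254, (2.18) p.257] -/
theorem prop8RegSepTopStepGB_gridGuard_lam_binders_inhabited (c c₀ c₁ : ℕ) {B₃ a₀ a₁ : ℝ} (hB₃ : 0 < B₃) (ha₀ : 0 < a₀) (ha₁ : 0 < a₁) :
    ∃ (ν : Stage7Numerics) (M : ℕ) (g : ℕ → ℝ) (K k : ℕ) (s : SeqOfRecord F ν M g K k) (ε₀ : ℝ) (δ : ℕ → ℝ) (W : MSField (F.P K) (SU N))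
      (U : GaugeField (F.P K) 0 (SU N)),
      Sect2.SeqSeparated ν.M₁ s ∧ 0 < ν.M₁ ∧
      (c ≤ ν.M₁ ∧ k + c₀ ≤ F.m + K ∧ F.L ^ c₁ ∣ M ∧
        ∀ i, 1 ≤ i → i ≤ k → dCubeSide (F.P K).L M (RkOfRecord (F.P K).L ν.r (g i)) i ∣ (F.P K).sitesPerDir 0) ∧ 1 ≤ k ∧
      (∀ n, n ≤ k → 0 < δ n ∧ δ n ≤ a₁ ∧ B₃ * δ n ≤ ε₀) ∧ (∀ n, n < k → δ n ≤ 2 * δ (n + 1)) ∧ (∀ n, n < k → δ (n + 1) ≤ 2 * δ n) ∧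
      ε₀ ≤ a₀ ∧ dataSmall7LamTopOf F N K s.Ω (suppDomOfRecord F ν K s.Ω) k δ W ∧
      (∀ n, n ≤ k → PlaqSmallOn (Sect2.omegaPlaqsTop s.Ω (suppDomOfRecord F ν K s.Ω) n) (ε₀ * (F.P K).eta n ^ 2) U) ∧
      Sect2.CoDivClassOnTop s.Ω (suppDomOfRecord F ν K s.Ω) k ε₀ U ∧ AgreeOnB (lamDatum F K k s.Ω) (avgFamily (avOfRecord F N K) U) W ∧
      IsCritOnFibreB F N K (lamDatum F K k s.Ω) W U ∧
      ((∀ n, n ≤ k → PlaqSmallOn (Sect2.omegaPlaqsTop s.Ω (suppDomOfRecord F ν K s.Ω) n) (B₃ * δ n * (F.P K).eta n ^ 2) U) ∧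
        ∀ n, n ≤ k → Sect2.CoDivSmallOn (Sect2.omegaBondsTop s.Ω (suppDomOfRecord F ν K s.Ω) n) (B₃ * δ n * (F.P K).eta n ^ 3) U) := by
  obtain ⟨ν, M, g, K, k, hM₁, hM, hk, hG⟩ := gridGuard_prefix_inhabited F c c₀ c₁
  obtain ⟨s, ε₀, δ, W, U, hsep, hM₁', hadm, hk', h⟩ :=
    prop8RegSepTopStepGB_binders_inhabited_flat_lam F N (fun ν K Ω => suppDomOfRecord F ν K Ω)
      (Adm := fun ν M g K k _s => c ≤ ν.M₁ ∧ k + c₀ ≤ F.m + K ∧ F.L ^ c₁ ∣ M ∧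
        ∀ i, 1 ≤ i → i ≤ k → dCubeSide (F.P K).L M (RkOfRecord (F.P K).L ν.r (g i)) i ∣ (F.P K).sitesPerDir 0)
      hB₃ ha₀ ha₁ ν hM₁ hM g K k hk (fun _ => hG)
  exact ⟨ν, M, g, K, k, s, ε₀, δ, W, U, hsep, hM₁', hadm, hk', h⟩

/-- ★★ The same at the guard for **Sect. F's one-step form** `HalvingStepTopGB F N suppDom (grid guard c c₀ c₁) (lamDatum F) (dataSmall7LamTopOf F N) B₃ a₀ a₁`: binder block AND
conclusion jointly inhabited, for every `(c, c₀, c₁)` and every `B₃, a₀, a₁ > 0`. [cite: Balaban1985Variational, Sect. F p.304, (2)–(7) p.278; Balaban1984PropagatorsII, (2.3) p.224; Balaban1988Convergent, (2.1) p.254] -/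
theorem halvingStepTopGB_gridGuard_lam_binders_inhabited (c c₀ c₁ : ℕ) {B₃ a₀ a₁ : ℝ} (hB₃ : 0 < B₃) (ha₀ : 0 < a₀) (ha₁ : 0 < a₁) :
    ∃ (ν : Stage7Numerics) (M : ℕ) (g : ℕ → ℝ) (K k : ℕ) (s : SeqOfRecord F ν M g K k) (ε δ : ℕ → ℝ) (W : MSField (F.P K) (SU N))
      (U : GaugeField (F.P K) 0 (SU N)),
      Sect2.SeqSeparated ν.M₁ s ∧ 0 < ν.M₁ ∧
      (c ≤ ν.M₁ ∧ k + c₀ ≤ F.m + K ∧ F.L ^ c₁ ∣ M ∧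
        ∀ i, 1 ≤ i → i ≤ k → dCubeSide (F.P K).L M (RkOfRecord (F.P K).L ν.r (g i)) i ∣ (F.P K).sitesPerDir 0) ∧ 1 ≤ k ∧
      (∀ n, n ≤ k → 0 < δ n ∧ δ n ≤ a₁) ∧ (∀ n, n < k → δ n ≤ 2 * δ (n + 1)) ∧ (∀ n, n < k → δ (n + 1) ≤ 2 * δ n) ∧
      (∀ n, n ≤ k → B₃ * δ n ≤ ε n ∧ ε n ≤ a₀) ∧ (∀ n, n < k → ε n ≤ 2 * ε (n + 1)) ∧ (∀ n, n < k → ε (n + 1) ≤ 2 * ε n) ∧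
      dataSmall7LamTopOf F N K s.Ω (suppDomOfRecord F ν K s.Ω) k δ W ∧
      (∀ n, n ≤ k → PlaqSmallOn (Sect2.omegaPlaqsTop s.Ω (suppDomOfRecord F ν K s.Ω) n) (ε n * (F.P K).eta n ^ 2) U) ∧
      (∀ n, n ≤ k → Sect2.CoDivSmallOn (Sect2.omegaBondsTop s.Ω (suppDomOfRecord F ν K s.Ω) n) (ε n * (F.P K).eta n ^ 3) U) ∧
      AgreeOnB (lamDatum F K k s.Ω) (avgFamily (avOfRecord F N K) U) W ∧ IsCritOnFibreB F N K (lamDatum F K k s.Ω) W U ∧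
      ((∀ n, n ≤ k → PlaqSmallOn (Sect2.omegaPlaqsTop s.Ω (suppDomOfRecord F ν K s.Ω) n) (max (B₃ * δ n) (ε n / 2) * (F.P K).eta n ^ 2) U) ∧
        ∀ n, n ≤ k → Sect2.CoDivSmallOn (Sect2.omegaBondsTop s.Ω (suppDomOfRecord F ν K s.Ω) n) (max (B₃ * δ n) (ε n / 2) * (F.P K).eta n ^ 3) U) := by
  obtain ⟨ν, M, g, K, k, hM₁, hM, hk, hG⟩ := gridGuard_prefix_inhabited F c c₀ c₁
  obtain ⟨s, ε, δ, W, U, hsep, hM₁', hadm, hk', h⟩ :=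
    halvingStepTopGB_binders_inhabited_flat_lam F N (fun ν K Ω => suppDomOfRecord F ν K Ω)
      (Adm := fun ν M g K k _s => c ≤ ν.M₁ ∧ k + c₀ ≤ F.m + K ∧ F.L ^ c₁ ∣ M ∧
        ∀ i, 1 ≤ i → i ≤ k → dCubeSide (F.P K).L M (RkOfRecord (F.P K).L ν.r (g i)) i ∣ (F.P K).sitesPerDir 0)
      hB₃ ha₀ ha₁ ν hM₁ hM g K k hk (fun _ => hG)
  exact ⟨ν, M, g, K, k, s, ε, δ, W, U, hsep, hM₁', hadm, hk', h⟩

end Token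

end Summit.QuantumFields.YangMills.BalabanUVNodes.K0GridGuardWitnessB

end
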